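import Summits.BirchSwinnertonDyer.Rank1Residual.X11b.ShapiroPairs
import HarnessLib

/-!
# BSD rank-≤1 residual cell, class X9: the last CHAIN-ONLY pair `56316n1 @ 5` gets a DIRECT closure from ONE full `5`-descent line — UNCONDITIONAL (Zimmert-certified class group)

HONEST FRAMING (cell `b2b-bsdres-*`, verbatim): the cell deletes COMBINATION-SHAPED residual classes of
the rank-≤1 BSD formula from PUBLISHED theorems only and TYPES the construction-shaped remainder; this
is not "finishing BSD". Class X9 stays TYPED at class level; everything here is PER PAIR; no lane
verdict is changed; no named fact; nothing is booked by this unit (the lane books, the referee rules).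
Unit `b2b-bsdres-x9`, gen 13.

`56316n1` (`N = 56316 = 2²·3·13·19²`, good ordinary at `5`, `ρ̄_{E,5}` of exceptional type `5S4`, analytic
rank `0`, `#Ш_an = 1`, Tamagawa numbers `c₃ = 10`, `c₁₃ = 5`) is the one X9 pair of Cremona's table
(`N < 5·10⁵`, 790 pairs) that the Heegner-index census of gens 5–12 could not reach DIRECTLY: the two
Tamagawa numbers divisible by `5` reappear on every Heegner twist, so `ord₅ [E(K) : ℤ y_K] ≥ 2` at EVERY
Heegner field (X9-CENSUS-G12 §2.4), Cha's bound gives only `ord₅ #Ш ≤ 4` and Jetchev's `≤ 2`; its route of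
record was the partner chain of gen 10 (`56316n1 ← 1444a1`, ruling R-CHAIN).  A `5`-DESCENT needs neither a
Heegner point nor an Euler system: unit `b2b-bsdres-x11c`'s gen-13 engine `s4desc`
(`HOME/code/b2b-bsdres-x11c/gen13/s4desc/`; method note `HOME/b2b-bsdres-x11c/gen13/S4DESCENT-METHOD.md`)
computes `Sel^(5)(E/ℚ)` for a `5S4` image inside `(Rˣ/Rˣ⁵)` of the degree-`24` field `R = ℚ(T′)` of a
`5`-torsion point (Schaefer–Stoll descent through the étale algebra of `E[5] ∖ 0`; image type ENFORCED by
the subfield lattice of `R`; `K_S(R)` contamination check; local images of known dimension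
`dim E(ℚ_ℓ)[5] + [ℓ = 5]` at every `ℓ ∈ S`; `5`-saturation by quintic characters; the Galois action on
the `S`-units proved by characters).  Run by this unit on byte copies (sha256 in
`HOME/code/b2b-bsdres-x9/g13/BYTE-COPIES-x11c-gen13.sha256`), kit j106749 (run of record on byte copies; the same curve also in j105079) (independent verifier kit j106749: VERIFIED):
`Cl(R) = [3, [3]]`, `Cl_S(R) = [1, []]`, `#gens R(S,5) = 39`, `5`-saturation `[1, 129, 39]`,
`dim K_S(R) = 0`, all local images complete, **`dim_𝔽₅ Sel^(5)(E/ℚ) = 0`**, i.e. `#Sel^(5)(E/ℚ) = 1 = 5 ^ r_an`;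
the class group of `R` (`bnfinit`: `Cl(R) = [3, [3]]`) is CERTIFIED UNCONDITIONALLY by a Zimmert certificate (Bordellès Thm. 7.51 bound `Z = 2311050`; every prime ideal of norm `≤ Z` decomposed on PARI's generators and the decomposition verified exactly, up to the free action of `Aut(R) ≅ C₄` on degree-1 primes; 170367 ideals, 0 failures; kit j106450) — so this certificate line is UNCONDITIONAL.
With `#Ш_an = 1` (a `5`-adic unit), `r_an = 0` and GZK the tree's class-free consumer
`X11b.bsdp_of_ainvs_of_card_selmerGroup` (= `Typed.bsdp_of_card_selmerGroup_eq_pow_analyticRank`) gives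
`BSD(E,5)`.  Non-kernel inputs displayed as binders exactly as in `X9/ShapiroPairs.lean`: `hGZK`
(published), `r_an ≤ 1` and `#Ш_an` (Cremona / the cell's engines), `hSel` (this certificate line, with the
status stated above).  Kernel-decided: `Δ ≠ 0`.  Census after gen 13: `HOME/b2b-bsdres-x9/X9-CENSUS-G13.md`.
-/

set_option autoImplicit false

noncomputable section

open scoped Classical

open WeierstrassCurve Literature.NumberTheory.EllipticCurves
  Literature.NumberTheory.EllipticCurves.Rank1Residual
  Literature.NumberTheory.EllipticCurves.Rank1Residual.Typed
  Summit.BirchSwinnertonDyer.Rank1Residual.X11b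

namespace Summit.BirchSwinnertonDyer.Rank1Residual.X9

/-- **`BSD(E,5)` for `56316n1`** (`N = 56316 = 2²·3·13·19²`; good ordinary at `5`, class X9; Cremona model
`[0, 1, 0, -7204236, 16612319412]`; image `5S4`; rank `0`, `#Ш_an = 1`; `c₂ = 1`, `c₃ = 10`, `c₁₃ = 5`, `c₁₉ = 1`)
— the last CHAIN-ONLY X9 pair — from GZK and the single certificate line `#Sel^(5)(E/ℚ) = 5 ^ r_an = 1`:
full `5`-descent over `R = ℚ(E[5]∖0)` (degree `24`), x11c gen-13 engine `s4desc` (byte copies), this unit's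
kit j106749 (run of record on byte copies; the same curve also in j105079): `dim_𝔽₅ Sel^(5)(E/ℚ) = 0` (mode GRH); the class group of `R` (`bnfinit`: `Cl(R) = [3, [3]]`) is CERTIFIED UNCONDITIONALLY by a Zimmert certificate (Bordellès Thm. 7.51 bound `Z = 2311050`; every prime ideal of norm `≤ Z` decomposed on PARI's generators and the decomposition verified exactly, up to the free action of `Aut(R) ≅ C₄` on degree-1 primes; 170367 ideals, 0 failures; kit j106450) — so this certificate line is UNCONDITIONAL.
Binders: `hGZK`, `r_an ≤ 1`, `#Ш_an` a `5`-adic unit, `hSel`. Kernel: `Δ ≠ 0`.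
[cite: Miller2011LMS, §1 and Def. 1.1] [cite: Cremona2006, Table 1 (Cremona label 56316n1)] -/
theorem bsdp_s56316n1 (hGZK : rank_eq_analyticRank_of_analyticRank_le_one)
    (W : WeierstrassCurve ℚ) (hW : W = ⟨0, 1, 0, -7204236, 16612319412⟩)
    (hr : W.analyticRank ≤ 1) {q : ℚ} (hq : shaAn W = (q : ℂ)) (hv : padicValRat 5 q = 0)
    (hSel : Nat.card (W.selmerGroup (5 : ℤ)) = 5 ^ W.analyticRank) : BSDp W 5 := by
  subst hW
  haveI : Fact (Nat.Prime 5) := ⟨by norm_num⟩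
  exact bsdp_of_ainvs_of_card_selmerGroup hGZK 0 1 0 (-7204236) 16612319412 (by decide +kernel) 5
    hr hq hv hSel

end Summit.BirchSwinnertonDyer.Rank1Residual.X9

end
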